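import Literature.Geometry.Riemannian.DistSqDirectionalDatum
import Literature.Geometry.Riemannian.ExpMapDifferential
import Literature.Geometry.Riemannian.LipschitzSmoothing
import HarnessLib

/-!
# Oscillation of a smooth function over a distance ball from a gradient bound
# (the geodesic step in Bamler 2020a, §7.2, (7.11))

R. Bamler, *Entropy and heat kernel bounds on a Ricci flow background*, arXiv:2008.07093 (2020a),
§7.2, proof of Thm. 7.1, between (7.10) and (7.11): from a bound on `|∇u|(·, t₁)` on a distance
ball `B` one gets "for any `x', x'' ∈ B`, `u(x', t₁) ≤ u(x'', t₁) + C ρ sup_B |∇u|`" — i.e. the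
oscillation of `u` over `B` is controlled by the gradient bound times the diameter, by integrating
`|d/dσ u(γ(σ))| ≤ |∇u| |γ'|` along minimising geodesics.

This file proves the statement in the form used by the tree's heat kernel bootstrap
(`HeatKernelBootstrapBall.lean`), on a compact connected Riemannian manifold modelled on `ℝᵐ`
(so that minimising unit-speed geodesics exist, `exists_unit_minimizing`, Hopf–Rinow):

* `abs_sub_le_mul_edist_of_sqrt_gradSq_le` — if `f` is `C^∞` and `|∇f|_g ≤ K` on the tripled
  ball `{d(z, ·) ≤ 3r}`, then `|f x' − f x''| ≤ K d(x', x'')` and `d(x', x'') < 2r` for all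
  `x', x''` with `d(z, x'), d(z, x'') < r` (a minimising geodesic from `x'` to `x''` stays in
  `{d(z, ·) ≤ 3r}`; Cauchy–Schwarz `|df(γ')| ≤ |∇f| |γ'|_g`, `abs_mvfderiv_le_sqrt_gradSq_mul_sqrt`;
  mean value inequality).

Everything is proved; no definitions, no named facts. What is NOT here: non-compact manifolds,
Lipschitz (non-smooth) `f`, the sharp statement on the ball `{d(z, ·) < r}` itself (geodesic
convexity is not used).

## References

* R. H. Bamler, *Entropy and heat kernel bounds on a Ricci flow background*, arXiv:2008.07093
  (2020), §7.2, proof of Thm. 7.1, (7.10)–(7.11). [Bamler2020Entropy]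
* J. M. Lee, *Introduction to Riemannian Manifolds*, 2nd ed., Springer GTM 176 (2018), Cor. 6.21
  (minimising geodesics on complete manifolds). [LeeRiemannianManifolds2018]
-/

noncomputable section

open Set Filter Function
open scoped Manifold ContDiff Topology ENNReal NNReal

namespace Literature.Geometry.Riemannian

open Lorentzian Lorentzian.PseudoRiemannianMetric

section Oscillation

variable {m : ℕ} {M : Type*} [TopologicalSpace M] [ChartedSpace (EuclideanSpace ℝ (Fin m)) M]
  [IsManifold 𝓘(ℝ, EuclideanSpace ℝ (Fin m)) ∞ M] [T2Space M] [CompactSpace M] [ConnectedSpace M]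

/-- **Oscillation of a function over a distance ball from a gradient bound on the tripled ball**
(the step "for any `x', x'' ∈ B`, `u(x') ≤ u(x'') + C ρ sup_B |∇u|`" of Bamler 2020a, §7.2,
(7.11)): on a compact connected Riemannian manifold modelled on `ℝᵐ`, if `f` is `C^∞` and
`|∇f|_g ≤ K` on `{d(z, ·) ≤ 3r}`, then for `x', x''` with `d(z, x'), d(z, x'') < r`,
`|f x' − f x''| ≤ K d(x', x'')` and `d(x', x'') < 2r`. Proof: join `x'` to `x''` by a minimising
unit-speed geodesic (Hopf–Rinow, `exists_unit_minimizing`); it stays in `{d(z, ·) ≤ 3r}`, along it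
`|(f ∘ γ)'| = |df(γ')| ≤ |∇f| |γ'| ≤ K` (Cauchy–Schwarz), and the mean value inequality applies.
[cite: Bamler2020Entropy, §7.2, proof of Thm. 7.1, (7.11)] -/
theorem abs_sub_le_mul_edist_of_sqrt_gradSq_le
    (g : PseudoRiemannianMetric 𝓘(ℝ, EuclideanSpace ℝ (Fin m)) ∞ (EuclideanSpace ℝ (Fin m))
      (TangentSpace 𝓘(ℝ, EuclideanSpace ℝ (Fin m)) : M → Type _)) (hg : g.IsRiemannian)
    {f : M → ℝ} (hf : ContMDiff 𝓘(ℝ, EuclideanSpace ℝ (Fin m)) 𝓘(ℝ, ℝ) ∞ f) (z : M) {r K : ℝ}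
    (hK : 0 ≤ K)
    (hgrad : ∀ w, g.edist hg z w ≤ ENNReal.ofReal (3 * r) → Real.sqrt (g.gradSq f w) ≤ K)
    {x' x'' : M} (hx' : g.edist hg z x' < ENNReal.ofReal r)
    (hx'' : g.edist hg z x'' < ENNReal.ofReal r) :
    |f x' - f x''| ≤ K * (g.edist hg x' x'').toReal ∧ (g.edist hg x' x'').toReal < 2 * r := by
  classical
  have hr : 0 < r := ENNReal.ofReal_pos.1 (lt_of_le_of_lt (by positivity) hx')
  -- `d(x', x'') < 2r`
  have hdlt : g.edist hg x' x'' < ENNReal.ofReal (2 * r) := by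
    calc g.edist hg x' x'' ≤ g.edist hg x' z + g.edist hg z x'' :=
          PseudoRiemannianMetric.edist_triangle hg _ _ _
      _ < ENNReal.ofReal r + ENNReal.ofReal r := by
          rw [PseudoRiemannianMetric.edist_comm hg x' z]
          exact ENNReal.add_lt_add hx' hx''
      _ = ENNReal.ofReal (2 * r) := by rw [← ENNReal.ofReal_add hr.le hr.le, two_mul]
  have hT2 : (g.edist hg x' x'').toReal < 2 * r := ENNReal.toReal_lt_of_lt_ofReal hdlt
  refine ⟨?_, hT2⟩
  by_cases hxx : x' = x''
  · subst hxx
    simp only [sub_self, abs_zero]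
    exact mul_nonneg hK ENNReal.toReal_nonneg
  -- geodesic set-up on `g`
  haveI : Fact ((1 : ℕ∞ω) ≤ (∞ : ℕ∞ω)) := ⟨by exact_mod_cast le_top⟩
  have h2 : (2 : ℕ∞ω) ≤ (∞ : ℕ∞ω) := WithTop.coe_le_coe.mpr le_top
  haveI := g.hasLeviCivita
  haveI : CovariantDerivative.ContMDiffCovariantDerivative g.leviCivita 1 :=
    contMDiffCovariantDerivative_leviCivita_of_two_le g h2
  haveI : CovariantDerivative.ContMDiffCovariantDerivative g.leviCivita ((⊤ : ℕ∞) : ℕ∞ω) :=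
    contMDiffCovariantDerivative_leviCivita_infty g le_rfl
  have hc : IsGeodesicallyComplete g.leviCivita :=
    isGeodesicallyComplete_of_compactSpace g h2 hg
  obtain ⟨u, T₀, hT₀, hu1, hexp, hdist⟩ := exists_unit_minimizing g hg hc hxx
  set γ : ℝ → M := maximalGeodesic g.leviCivita x' u with hγ_def
  have hγs : ContMDiff 𝓘(ℝ, ℝ) 𝓘(ℝ, EuclideanSpace ℝ (Fin m)) ∞ γ :=
    (contMDiff_maximalGeodesic_family hc x').comp
      (contMDiff_id.prodMk (contMDiff_const (c := (show EuclideanSpace ℝ (Fin m) from u))))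
  obtain ⟨-, -, hγ0, -⟩ := maximalGeodesic_of_isGeodesicallyComplete hc x' u
  have hγ0' : γ 0 = x' := hγ0
  have hγT : γ T₀ = x'' := by rw [hγ_def, ← expMap_smul hc x' u T₀]; exact hexp
  -- derivative of `f ∘ γ`
  have hderiv : ∀ σ, HasDerivAt (fun σ ↦ f (γ σ))
      (mvfderiv 𝓘(ℝ, EuclideanSpace ℝ (Fin m)) f (γ σ)
        (velocity 𝓘(ℝ, EuclideanSpace ℝ (Fin m)) γ σ)) σ := fun σ ↦
    hasDerivAt_comp_curve_mvfderiv (hf.mdifferentiableAt (by simp))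
      (hγs.mdifferentiableAt (by simp))
  -- derivative bound on `[0, T₀]`: the segment stays in `{d(z, ·) ≤ 3r}`
  have hbound : ∀ σ ∈ Icc (0 : ℝ) T₀, ‖deriv (fun σ ↦ f (γ σ)) σ‖ ≤ K := by
    intro σ hσ
    rw [(hderiv σ).deriv, Real.norm_eq_abs]
    have hCS := abs_mvfderiv_le_sqrt_gradSq_mul_sqrt g hg f (γ σ)
      (velocity 𝓘(ℝ, EuclideanSpace ℝ (Fin m)) γ σ)
    rw [hγ_def, val_velocity_maximalGeodesic hc x' u σ, hu1, Real.sqrt_one, mul_one] at hCS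
    refine hCS.trans (hgrad _ ?_)
    have h1 : g.edist hg x' (maximalGeodesic g.leviCivita x' u σ) ≤ ENNReal.ofReal σ := by
      have h := edist_maximalGeodesic_le hg hc x' hu1 hσ.1
      rwa [hγ0, sub_zero] at h
    calc g.edist hg z (maximalGeodesic g.leviCivita x' u σ)
        ≤ g.edist hg z x' + g.edist hg x' (maximalGeodesic g.leviCivita x' u σ) :=
          PseudoRiemannianMetric.edist_triangle hg _ _ _
      _ ≤ ENNReal.ofReal r + ENNReal.ofReal σ := add_le_add hx'.le h1
      _ = ENNReal.ofReal (r + σ) := (ENNReal.ofReal_add hr.le hσ.1).symm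
      _ ≤ ENNReal.ofReal (3 * r) := ENNReal.ofReal_le_ofReal (by linarith [hσ.2])
  have hMVT := Convex.norm_image_sub_le_of_norm_deriv_le (f := fun σ ↦ f (γ σ)) (s := Icc 0 T₀)
    (fun σ _ ↦ (hderiv σ).differentiableAt) hbound (convex_Icc 0 T₀)
    (left_mem_Icc.2 hT₀.le) (right_mem_Icc.2 hT₀.le)
  rw [Real.norm_eq_abs, Real.norm_eq_abs, sub_zero, abs_of_pos hT₀, hγT, hγ0'] at hMVT
  rw [abs_sub_comm, hdist]
  exact hMVT

end Oscillation

end Literature.Geometry.Riemannian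

end
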